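import Mathlib
import Literature.Geometry.DiscreteGeometry.BondGraph
import Literature.MathematicalPhysics.StatisticalMechanics.BarlowCoordination

/-!
# `StackingHinge` (stmt-AtomisticToContinuum-14993), line `Sketch`: stub `stub_bondShellTransfer`

Transfer of the `1 %` bond shell of a charge-free, SLP-matched site to an `ε`-close rooted set.

Data.  A finite configuration `y : Fin N → ℝ³`, a site `i` with scale `a = nearestDist y i`,
charge-free at tolerance `1/100` (twelve bonds `j`, `a ≤ dist (y i) (y j) ≤ 1.01 a`) and
SLP-matched: a rigid image `g Λ` of an ideal Barlow stacking `Λ = barlowStacking a (a √(2/3)) s`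
matches every site within `3a` of `y i` at tolerance `a/6`.  A set `S ∋ 0`, `2ε`-separated, two-way
`ε`-close inside radius `R ≥ 2a + 1` to the recentred configuration `{y k - y i}`; scales
`400 ε ≤ θ a`, `θ ≤ 1/100`.  HYPOTHESIS (the neighbouring stub `stub_barlowSecondShellGap`,
verbatim): two points of an ideal Barlow stacking at squared distance `< 2a²` coincide or are at
distance exactly `a`.

Conclusion, with `nn' = Metric.infDist 0 (S ∖ {0})`: (gap) every `p ∈ S ∖ {0}` with
`‖p‖ < 1.07 nn'` has `‖p‖ ≤ (1.01 + θ) nn'`; (twelve) twelve distinct points of `S ∖ {0}` have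
norm `≤ (1.01 + θ) nn'`.

Proof.
* `|nn' - a| ≤ ε`: a point `p ∈ S ∖ {0}`, `‖p‖ ≤ R`, is `ε`-close to some `y k - y i` with
  `k ≠ i` (for `k = i` it would be `ε`-close to the root, against separation), so `‖p‖ ≥ a - ε`;
  the nearest neighbour of `i` produces a point of `S ∖ {0}` of norm `≤ a + ε`.
* KEY (`dist_eq_of_close`): if `k ≠ i` and `dist (y i) (y k) < 1.0752 a`, the stacking partners
  `zᵢ, z_k` of `y i, y k` satisfy `dist zᵢ z_k < (1/3 + 1.0752) a`, squared `< 2a²`, and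
  `zᵢ ≠ z_k` (else `dist (y i) (y k) ≤ a/3 < a`); by the hypothesis `dist zᵢ z_k = a`: `z_k` lies
  in the first shell `F` of `zᵢ`, which has exactly twelve points (`ncard_touching_eq_twelve`).
* The twelve bonded neighbours `j` of `i` have pairwise distinct partners (a common partner
  forces `dist (y j) (y j') ≤ a/3 < nn_j`), so `j ↦ z_j` is a bijection onto `F`.
* (gap) `p` is `ε`-close to `y k - y i`, `‖y k - y i‖ < 1.07 a + 2.07 ε ≤ 1.0752 a`, so
  `z_k ∈ F`, `z_k = z_j` for a bonded `j`, and `k = j` (else `nn_j ≤ dist (y j) (y k) ≤ a/3`);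
  hence `‖p‖ ≤ 1.01 a + ε ≤ (1.01 + θ) nn'`.
* (twelve) the `ε`-partners `p_j ∈ S` of the twelve `y j - y i` are nonzero, of norm
  `≤ 1.01 a + ε`, and pairwise distinct (`dist (y j) (y j') ≥ nn_j > 2ε`).
-/

noncomputable section

namespace Summit.AtomisticToContinuum.Crystallization.Theorems.PricedHcpWindowsBondShellTransfer

open Literature.Geometry.DiscreteGeometry Literature.MathematicalPhysics.StatisticalMechanics

/-! ## Elementary facts -/

/-- `|‖q‖ - ‖p‖| ≤ dist q p`. [folklore] -/
theorem abs_norm_sub_norm_le_dist (q p : EuclideanSpace ℝ (Fin 3)) : |‖q‖ - ‖p‖| ≤ dist q p := by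
  rw [dist_eq_norm]
  exact abs_norm_sub_norm_le q p

/-- The scale inequalities `0 < ε`, `0 < θ ≤ 1/100`, `400 ε ≤ θ a` force `0 < a` and
`40000 ε ≤ a`. [folklore] -/
theorem scale_bounds {a ε θ : ℝ} (hε : 0 < ε) (hθ : 0 < θ) (hθ1 : θ ≤ 1 / 100)
    (h400 : 400 * ε ≤ θ * a) : 0 < a ∧ 40000 * ε ≤ a := by
  have hθa : 0 < θ * a := by linarith
  have ha : 0 < a := (pos_iff_pos_of_mul_pos hθa).1 hθ
  have : θ * a ≤ 1 / 100 * a := mul_le_mul_of_nonneg_right hθ1 ha.le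
  exact ⟨ha, by linarith⟩

/-- The final real-arithmetic step: `x ≤ 1.01 a + ε ≤ (1.01 + θ) nn'` as soon as `nn' ≥ a - ε`,
`400 ε ≤ θ a` and `θ ≤ 1/100`. [folklore] -/
theorem le_mul_of_le_add {a ε θ nn' x : ℝ} (hε : 0 < ε) (hθ : 0 < θ) (hθ1 : θ ≤ 1 / 100)
    (h400 : 400 * ε ≤ θ * a) (hlo : a - ε ≤ nn') (hx : x ≤ 101 / 100 * a + ε) :
    x ≤ (101 / 100 + θ) * nn' := by
  have h1 : (101 / 100 + θ) * (a - ε) ≤ (101 / 100 + θ) * nn' :=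
    mul_le_mul_of_nonneg_left hlo (by linarith)
  have h2 : θ * ε ≤ 1 / 100 * ε := mul_le_mul_of_nonneg_right hθ1 hε.le
  linarith

/-- **The key metric step.**  Two stacking points `zi, w` whose rigid images are `a/6`-close to
two points `u, v` with `a ≤ dist u v < 1.0752 a` are at distance `< (1/3 + 1.0752) a`, squared
`< 2 a²`, and distinct; so, granted the second-shell gap alternative, `dist zi w = a`. [folklore] -/
theorem dist_eq_of_close {a : ℝ} (g : EuclideanSpace ℝ (Fin 3) ≃ᵃⁱ[ℝ] EuclideanSpace ℝ (Fin 3))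
    {u v zi w : EuclideanSpace ℝ (Fin 3)}
    (hgap : dist zi w ^ 2 < 2 * a ^ 2 → zi = w ∨ dist zi w = a)
    (hu : dist u (g zi) ≤ a / 6) (hv : dist v (g w) ≤ a / 6)
    (huv : dist u v < 672 / 625 * a) (hle : a ≤ dist u v) : dist zi w = a := by
  have hd : dist zi w < 2641 / 1875 * a := by
    rw [← g.dist_map]
    calc dist (g zi) (g w) ≤ dist (g zi) u + dist u v + dist v (g w) := dist_triangle4 _ _ _ _
      _ < a / 6 + 672 / 625 * a + a / 6 := by rw [dist_comm (g zi) u]; linarith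
      _ = 2641 / 1875 * a := by ring
  have hd2 : dist zi w ^ 2 < 2 * a ^ 2 := by
    have h3 : dist zi w ^ 2 < (2641 / 1875 * a) ^ 2 :=
      sq_lt_sq' (by linarith [dist_nonneg (x := zi) (y := w)]) hd
    nlinarith [sq_nonneg a]
  rcases hgap hd2 with rfl | h
  · have : dist u v ≤ a / 6 + a / 6 := (dist_triangle_right u v _).trans (add_le_add hu hv)
    linarith
  · exact h

/-! ## The rooted set near the origin -/

section Transfer

variable {N : ℕ} {y : Fin N → EuclideanSpace ℝ (Fin 3)} {i : Fin N}
  {S : Set (EuclideanSpace ℝ (Fin 3))} {R ε : ℝ}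

/-- A point of `S ∖ {0}` inside radius `R` is `ε`-close to some `y k - y i` with `k ≠ i`
(for `k = i` it would be `ε`-close to the root `0 ∈ S`, against `2ε`-separation). [folklore] -/
theorem exists_partner_ne (h0S : (0 : EuclideanSpace ℝ (Fin 3)) ∈ S)
    (hsep : ∀ p ∈ S, ∀ p' ∈ S, p ≠ p' → 2 * ε < dist p p')
    (hA : ∀ p ∈ S, ‖p‖ ≤ R → ∃ k : Fin N, dist (y k - y i) p ≤ ε)
    {p : EuclideanSpace ℝ (Fin 3)} (hpS : p ∈ S) (hp0 : p ≠ 0) (hpR : ‖p‖ ≤ R) :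
    ∃ k : Fin N, k ≠ i ∧ dist (y k - y i) p ≤ ε := by
  obtain ⟨k, hk⟩ := hA p hpS hpR
  refine ⟨k, ?_, hk⟩
  rintro rfl
  have h2 := hsep p hpS 0 h0S hp0
  rw [sub_self, dist_zero_left] at hk
  rw [dist_zero_right] at h2
  linarith [norm_nonneg p]

/-- Hence every point of `S ∖ {0}` has norm `≥ nn_i - ε` (points outside radius `R ≥ 2 nn_i + 1`
trivially). [folklore] -/
theorem sub_le_norm_of_mem (hε : 0 < ε) (hR : 2 * nearestDist y i + 1 ≤ R)
    (h0S : (0 : EuclideanSpace ℝ (Fin 3)) ∈ S)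
    (hsep : ∀ p ∈ S, ∀ p' ∈ S, p ≠ p' → 2 * ε < dist p p')
    (hA : ∀ p ∈ S, ‖p‖ ≤ R → ∃ k : Fin N, dist (y k - y i) p ≤ ε)
    {p : EuclideanSpace ℝ (Fin 3)} (hpS : p ∈ S) (hp0 : p ≠ 0) :
    nearestDist y i - ε ≤ ‖p‖ := by
  by_cases hpR : ‖p‖ ≤ R
  · obtain ⟨k, hki, hk⟩ := exists_partner_ne h0S hsep hA hpS hp0 hpR
    have h1 : nearestDist y i ≤ ‖y k - y i‖ := by
      rw [← dist_eq_norm, dist_comm]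
      exact nearestDist_le_dist y hki
    obtain ⟨-, h2⟩ := abs_le.1 (abs_norm_sub_norm_le_dist (y k - y i) p)
    linarith
  · have := nearestDist_nonneg y i
    linarith [not_le.1 hpR]

/-- A charge-free site has a nearest neighbour `k₀` (`‖y k₀ - y i‖ = nn_i ≤ R`); its `ε`-close
point of `S` is nonzero and has norm `≤ nn_i + ε`. [folklore] -/
theorem exists_mem_norm_le (hεa : ε < nearestDist y i) (hR : 2 * nearestDist y i + 1 ≤ R)
    (hcf : IsChargeFree (1 / 100 : ℝ) y i)
    (hB : ∀ k : Fin N, ‖y k - y i‖ ≤ R → ∃ p ∈ S, dist (y k - y i) p ≤ ε) :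
    ∃ p ∈ S, p ≠ 0 ∧ ‖p‖ ≤ nearestDist y i + ε := by
  have hne : ∃ k, k ≠ i := by
    obtain ⟨j, hj⟩ := Set.nonempty_of_ncard_ne_zero
      (s := (bondGraph (1 / 100 : ℝ) y).neighborSet i) (by rw [hcf.ncard_neighborSet]; decide)
    exact ⟨j, fun h => (mem_neighborSet_bondGraph.1 hj).1 h.symm⟩
  obtain ⟨k, hki, hk⟩ := exists_nearestDist_eq_dist y hne
  have hnorm : ‖y k - y i‖ = nearestDist y i := by rw [← dist_eq_norm, dist_comm, ← hk]
  obtain ⟨p, hpS, hp⟩ := hB k (by rw [hnorm]; linarith [nearestDist_nonneg y i])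
  obtain ⟨h1, h2⟩ := abs_le.1 (abs_norm_sub_norm_le_dist (y k - y i) p)
  refine ⟨p, hpS, fun hp0 => ?_, by linarith⟩
  have : ‖p‖ = 0 := by rw [hp0, norm_zero]
  linarith

/-- `nn' ≤ nn_i + ε`, `nn' = Metric.infDist 0 (S ∖ {0})`. [folklore] -/
theorem infDist_le (hεa : ε < nearestDist y i) (hR : 2 * nearestDist y i + 1 ≤ R)
    (hcf : IsChargeFree (1 / 100 : ℝ) y i)
    (hB : ∀ k : Fin N, ‖y k - y i‖ ≤ R → ∃ p ∈ S, dist (y k - y i) p ≤ ε) :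
    Metric.infDist (0 : EuclideanSpace ℝ (Fin 3)) (S \ {0}) ≤ nearestDist y i + ε := by
  obtain ⟨p, hpS, hp0, hp⟩ := exists_mem_norm_le hεa hR hcf hB
  calc Metric.infDist (0 : EuclideanSpace ℝ (Fin 3)) (S \ {0}) ≤ dist 0 p :=
        Metric.infDist_le_dist_of_mem (Set.mem_sdiff_singleton.2 ⟨hpS, hp0⟩)
    _ = ‖p‖ := dist_zero_left p
    _ ≤ nearestDist y i + ε := hp

/-- `nn_i - ε ≤ nn'`, `nn' = Metric.infDist 0 (S ∖ {0})`. [folklore] -/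
theorem sub_le_infDist (hε : 0 < ε) (hεa : ε < nearestDist y i)
    (hR : 2 * nearestDist y i + 1 ≤ R)
    (hcf : IsChargeFree (1 / 100 : ℝ) y i) (h0S : (0 : EuclideanSpace ℝ (Fin 3)) ∈ S)
    (hsep : ∀ p ∈ S, ∀ p' ∈ S, p ≠ p' → 2 * ε < dist p p')
    (hA : ∀ p ∈ S, ‖p‖ ≤ R → ∃ k : Fin N, dist (y k - y i) p ≤ ε)
    (hB : ∀ k : Fin N, ‖y k - y i‖ ≤ R → ∃ p ∈ S, dist (y k - y i) p ≤ ε) :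
    nearestDist y i - ε ≤ Metric.infDist (0 : EuclideanSpace ℝ (Fin 3)) (S \ {0}) := by
  obtain ⟨p, hpS, hp0, -⟩ := exists_mem_norm_le hεa hR hcf hB
  refine (Metric.le_infDist ⟨p, Set.mem_sdiff_singleton.2 ⟨hpS, hp0⟩⟩).2 fun q hq => ?_
  obtain ⟨hqS, hq0⟩ := Set.mem_sdiff_singleton.1 hq
  rw [dist_zero_left]
  exact sub_le_norm_of_mem hε hR h0S hsep hA hqS hq0

/-- Facts about a bonded neighbour `j` of `i` at tolerance `1/100`: `j ≠ i`,
`nn_i ≤ dist (y i) (y j) ≤ 1.01 nn_i`, `nn_j ≥ nn_i / 1.01`. [folklore] -/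
theorem neighbor_facts {j : Fin N} (hj : j ∈ (bondGraph (1 / 100 : ℝ) y).neighborSet i) :
    j ≠ i ∧ nearestDist y i ≤ dist (y i) (y j) ∧
      dist (y i) (y j) ≤ 101 / 100 * nearestDist y i ∧
        100 / 101 * nearestDist y i ≤ nearestDist y j := by
  obtain ⟨hij, hle⟩ := mem_neighborSet_bondGraph.1 hj
  have hji : j ≠ i := fun h => hij h.symm
  have h1 := nearestDist_le_dist y hji
  have hm1 := min_le_left (nearestDist y i) (nearestDist y j)
  have hm2 := min_le_right (nearestDist y i) (nearestDist y j)
  exact ⟨hji, h1, by linarith, by linarith⟩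

end Transfer

/-! ## The stub -/

/-- **Stub `stub_bondShellTransfer` of line `Sketch`.**  Granted the second-shell gap of ideal
Barlow stackings (first hypothesis, the statement of the neighbouring stub
`stub_barlowSecondShellGap`), the `1 %` bond shell of a charge-free, SLP-matched site `i` is
transferred to any `2ε`-separated rooted set `S ∋ 0` two-way `ε`-close to the configuration
recentred at `y i`: no point of `S ∖ {0}` has norm in `[(1.01 + θ) nn', 1.07 nn')`, and twelve
points of `S ∖ {0}` have norm `≤ (1.01 + θ) nn'` (`nn' = Metric.infDist 0 (S ∖ {0})`).  See the
module docstring for the proof. [folklore] -/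
theorem stub_bondShellTransfer : (∀ (a : ℝ) (s : ℤ → ℤ), 0 < a → Literature.MathematicalPhysics.StatisticalMechanics.IsHaggSeq s → ∀ z ∈ Literature.MathematicalPhysics.StatisticalMechanics.barlowStacking a (a * Real.sqrt (2 / 3)) s, ∀ z' ∈ Literature.MathematicalPhysics.StatisticalMechanics.barlowStacking a (a * Real.sqrt (2 / 3)) s, dist z z' ^ 2 < 2 * a ^ 2 → z = z' ∨ dist z z' = a) → ∀ (N : ℕ) (y : Fin N → EuclideanSpace ℝ (Fin 3)) (i : Fin N) (S : Set (EuclideanSpace ℝ (Fin 3))) (R ε θ : ℝ), 0 < ε → 0 < θ → θ ≤ 1 / 100 → 400 * ε ≤ θ * Literature.Geometry.DiscreteGeometry.nearestDist y i → 2 * Literature.Geometry.DiscreteGeometry.nearestDist y i + 1 ≤ R → (∃ s : ℤ → ℤ, Literature.MathematicalPhysics.StatisticalMechanics.IsHaggSeq s ∧ ∃ g : EuclideanSpace ℝ (Fin 3) ≃ᵃⁱ[ℝ] EuclideanSpace ℝ (Fin 3), (∀ j : Fin N, dist (y i) (y j) ≤ 3 * Literature.Geometry.DiscreteGeometry.nearestDist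 y i → ∃ z ∈ Literature.MathematicalPhysics.StatisticalMechanics.barlowStacking (Literature.Geometry.DiscreteGeometry.nearestDist y i) (Literature.Geometry.DiscreteGeometry.nearestDist y i * Real.sqrt (2 / 3)) s, dist (y j) (g z) ≤ Literature.Geometry.DiscreteGeometry.nearestDist y i / 6) ∧ (∀ z ∈ Literature.MathematicalPhysics.StatisticalMechanics.barlowStacking (Literature.Geometry.DiscreteGeometry.nearestDist y i) (Literature.Geometry.DiscreteGeometry.nearestDist y i * Real.sqrt (2 / 3)) s, dist (y i) (g z) ≤ 3 * Literature.Geometry.DiscreteGeometry.nearestDist y i → ∃ j : Fin N, dist (y j) (g z) ≤ Literature.Geometry.DiscreteGeometry.nearestDist y i / 6)) → Literature.Geometry.DiscreteGeometry.IsChargeFree (1 / 100 : ℝ) y i → (0 : EuclideanSpace ℝ (Fin 3)) ∈ S → (∀ p ∈ S, ∀ p' ∈ S, p ≠ p' → 2 * ε < dist p p') → (∀ p ∈ S, ‖p‖ ≤ R → ∃ k : Fin N, dist (y k - y i) p ≤ ε) ∧ (∀ k : Fin N, ‖y k - y i‖ ≤ R → ∃ p ∈ S, dist (y k - y i) p ≤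 ε) → (∀ p ∈ S, p ≠ 0 → ‖p‖ < 107 / 100 * Metric.infDist (0 : EuclideanSpace ℝ (Fin 3)) (S \ {0}) → ‖p‖ ≤ (101 / 100 + θ) * Metric.infDist (0 : EuclideanSpace ℝ (Fin 3)) (S \ {0})) ∧ ∃ T : Finset (EuclideanSpace ℝ (Fin 3)), (↑T : Set (EuclideanSpace ℝ (Fin 3))) ⊆ {p : EuclideanSpace ℝ (Fin 3) | p ∈ S ∧ p ≠ 0 ∧ ‖p‖ ≤ (101 / 100 + θ) * Metric.infDist (0 : EuclideanSpace ℝ (Fin 3)) (S \ {0})} ∧ T.card = 12 := by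
  intro hGAP N y i S R ε θ hε hθ hθ1 h400 hR hSLP hcf h0S hsep hclose
  obtain ⟨hcl1, hcl2⟩ := hclose
  obtain ⟨ha, hεa⟩ := scale_bounds hε hθ hθ1 h400
  have hεa' : ε < nearestDist y i := by linarith
  have hup := infDist_le hεa' hR hcf hcl2
  have hlo := sub_le_infDist hε hεa' hR hcf h0S hsep hcl1 hcl2
  set a := nearestDist y i with ha_def
  set nn' := Metric.infDist (0 : EuclideanSpace ℝ (Fin 3)) (S \ {0}) with hnn'_def
  -- the SLP data: word `s`, rigid motion `g`, partners `Z k` of the sites within `3a` of `y i`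
  obtain ⟨s, hs, g, h1, -⟩ := hSLP
  obtain ⟨zi, hzi, hzii⟩ := h1 i (by rw [dist_self]; linarith)
  have hZex : ∀ k : Fin N, ∃ z : EuclideanSpace ℝ (Fin 3), dist (y i) (y k) ≤ 3 * a →
      z ∈ barlowStacking a (a * Real.sqrt (2 / 3)) s ∧ dist (y k) (g z) ≤ a / 6 := by
    intro k
    by_cases hk : dist (y i) (y k) ≤ 3 * a
    · obtain ⟨z, hz, hzk⟩ := h1 k hk
      exact ⟨z, fun _ => ⟨hz, hzk⟩⟩
    · exact ⟨0, fun h => absurd h hk⟩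
  choose Z hZ using hZex
  -- the first shell `F` of `zi`: twelve points
  have hh : (a * Real.sqrt (2 / 3)) ^ 2 = 2 / 3 * a ^ 2 := by
    rw [mul_pow, Real.sq_sqrt (by norm_num : (0 : ℝ) ≤ 2 / 3)]; ring
  set F : Set (EuclideanSpace ℝ (Fin 3)) :=
    {w | w ∈ barlowStacking a (a * Real.sqrt (2 / 3)) s ∧ dist zi w = a} with hF_def
  have hFcard : F.ncard = 12 := ncard_touching_eq_twelve hs ha hh hzi
  have hFfin : F.Finite := Set.finite_of_ncard_ne_zero (by rw [hFcard]; decide)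
  -- partners of the sites `k ≠ i` closer than `1.0752 a` lie in `F`
  have hZF : ∀ k : Fin N, k ≠ i → dist (y i) (y k) < 672 / 625 * a → Z k ∈ F := by
    intro k hki hdk
    obtain ⟨hZΛ, hZd⟩ := hZ k (by linarith)
    exact ⟨hZΛ, dist_eq_of_close g (hGAP a s ha hs zi hzi (Z k) hZΛ) hzii hZd hdk
      (nearestDist_le_dist y hki)⟩
  -- the twelve bonded neighbours `B` of `i` and their partners
  have hBcard := hcf.ncard_neighborSet
  have hBfin := hcf.finite_neighborSet
  set B := (bondGraph (1 / 100 : ℝ) y).neighborSet i with hB_def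
  have hBfacts : ∀ j ∈ B, j ≠ i ∧ a ≤ dist (y i) (y j) ∧ dist (y i) (y j) ≤ 101 / 100 * a ∧
      100 / 101 * a ≤ nearestDist y j := fun j hj => neighbor_facts hj
  have hZB : ∀ j ∈ B, Z j ∈ F := fun j hj => by
    obtain ⟨hji, -, hdj, -⟩ := hBfacts j hj
    exact hZF j hji (by linarith)
  -- a bonded neighbour sharing its partner with a `3a`-close site coincides with it
  have hZinj : ∀ j ∈ B, ∀ k : Fin N, dist (y i) (y k) ≤ 3 * a → Z j = Z k → j = k := by
    intro j hj k hk he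
    obtain ⟨-, -, hdj, hnnj⟩ := hBfacts j hj
    by_contra hne
    have h3 : dist (y j) (y k) ≤ a / 3 := by
      have hdk := (hZ k hk).2
      rw [← he] at hdk
      linarith [dist_triangle_right (y j) (y k) (g (Z j)), (hZ j (by linarith)).2]
    have h4 : nearestDist y j ≤ dist (y j) (y k) := nearestDist_le_dist y (Ne.symm hne)
    linarith
  -- so `j ↦ Z j` maps `B` onto `F`
  have himage : Z '' B = F := by
    refine Set.eq_of_subset_of_ncard_le ?_ ?_ hFfin
    · rintro _ ⟨j, hj, rfl⟩
      exact hZB j hj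
    · have hinj : Set.InjOn Z B := fun j hj k hk he =>
        hZinj j hj k (by linarith [(hBfacts k hk).2.2.1]) he
      rw [hinj.ncard_image, hBcard, hFcard]
  have hnorm : ∀ k : Fin N, dist (y i) (y k) = ‖y k - y i‖ := fun k => by
    rw [dist_comm, dist_eq_norm]
  refine ⟨fun p hpS hp0 hp => ?_, ?_⟩
  · -- the gap clause
    have hpR : ‖p‖ ≤ R := by linarith
    obtain ⟨k, hki, hk⟩ := exists_partner_ne h0S hsep hcl1 hpS hp0 hpR
    obtain ⟨hk1, hk2⟩ := abs_le.1 (abs_norm_sub_norm_le_dist (y k - y i) p)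
    have hdk : dist (y i) (y k) < 672 / 625 * a := by rw [hnorm]; linarith
    have hZk : Z k ∈ F := hZF k hki hdk
    rw [← himage] at hZk
    obtain ⟨j, hjB, hjk⟩ := hZk
    have hjk' : j = k := hZinj j hjB k (by linarith) hjk
    obtain ⟨-, -, hdj, -⟩ := hBfacts k (hjk' ▸ hjB)
    rw [hnorm] at hdj
    exact le_mul_of_le_add hε hθ hθ1 h400 hlo (by linarith)
  · -- the twelve clause: the `ε`-partners `P j ∈ S` of the twelve `y j - y i`, `j ∈ B`
    have hPex : ∀ k : Fin N, ∃ p : EuclideanSpace ℝ (Fin 3), ‖y k - y i‖ ≤ R →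
        p ∈ S ∧ dist (y k - y i) p ≤ ε := by
      intro k
      by_cases hk : ‖y k - y i‖ ≤ R
      · obtain ⟨p, hpS, hp⟩ := hcl2 k hk
        exact ⟨p, fun _ => ⟨hpS, hp⟩⟩
      · exact ⟨0, fun h => absurd h hk⟩
    choose P hP using hPex
    have hBR : ∀ j ∈ B, ‖y j - y i‖ ≤ R := fun j hj => by
      rw [← hnorm]; linarith [(hBfacts j hj).2.2.1]
    have hinjP : Set.InjOn P B := by
      intro j hj k hk he
      by_contra hne
      obtain ⟨-, -, -, hnnj⟩ := hBfacts j hj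
      obtain ⟨-, hPdj⟩ := hP j (hBR j hj)
      obtain ⟨-, hPdk⟩ := hP k (hBR k hk)
      have h3 : dist (y j) (y k) ≤ 2 * ε := by
        rw [← dist_sub_right (y j) (y k) (y i)]
        calc dist (y j - y i) (y k - y i)
            ≤ dist (y j - y i) (P j) + dist (y k - y i) (P j) := dist_triangle_right _ _ _
          _ ≤ ε + ε := add_le_add hPdj (by rw [he]; exact hPdk)
          _ = 2 * ε := by ring
      have h4 : nearestDist y j ≤ dist (y j) (y k) := nearestDist_le_dist y (Ne.symm hne)
      linarith
    classical
    refine ⟨hBfin.toFinset.image P, ?_, ?_⟩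
    · intro p hp
      rw [Finset.coe_image, Set.Finite.coe_toFinset] at hp
      obtain ⟨j, hjB, rfl⟩ := hp
      obtain ⟨-, haj, hdj, -⟩ := hBfacts j hjB
      obtain ⟨hPS, hPd⟩ := hP j (hBR j hjB)
      obtain ⟨h1, h2⟩ := abs_le.1 (abs_norm_sub_norm_le_dist (y j - y i) (P j))
      rw [hnorm] at haj hdj
      refine ⟨hPS, fun h0 => ?_, le_mul_of_le_add hε hθ hθ1 h400 hlo (by linarith)⟩
      have : ‖P j‖ = 0 := by rw [h0, norm_zero]
      linarith
    · rw [Finset.card_image_of_injOn (by rwa [Set.Finite.coe_toFinset]),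
        ← Set.ncard_eq_toFinset_card B hBfin]
      exact hBcard

end Summit.AtomisticToContinuum.Crystallization.Theorems.PricedHcpWindowsBondShellTransfer

end
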